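import Summits.HodgeConjecture.HodgeConjecture.Theorems.LinearSystemTorelliMiddleDivisorSupportFourfoldOfLineResidueOfTypeStability
import Summits.HodgeConjecture.HodgeConjecture.Theorems.LinearSystemTorelliMiddleDivisorSupportOfPeriodDeficiency
import HarnessLib

/-!
# Route `LinearSystemTorelli` — support item `MiddleDivisorSupport` (stmt-HodgeConjecture-1081, all
# even dimensions): the two-classical-debt residue with type stability (kernel-checked)

Helper file for the support item stmt-HodgeConjecture-1081 `LinearSystemTorelli.MiddleDivisorSupport`
(`--supports`; it closes nothing) — every rational `(p,p)` class in the middle degree of a smooth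
projective complex `2p`-fold (`p ≥ 1`) is supported on a divisor; its `p = 2` instance is the crux
`MiddleDivisorSupportFourfold` (stmt-2409).  The registered residue of the item
(`linearSystemTorelli_middleDivisorSupport_of_periodDeficiency`, p119978) has SEVEN hypotheses:
`ClassicalGeometricVHS` (stmt-11597), `QbarGenericIsHodgeGeneric` (stmt-11595), `HodgeConjectureQbar`
(stmt-11596) and the named facts `bku_finite_monodromyOrbit_of_isHodgeGenericIn`,
`riemannExistence_qbarDescent_of_finiteIndex`, `deligne_globalInvariantCycles`,
`charlesSchnell2014_algebraicClasses_supportedOn_qbarClosed`.  Since then the tree PROVED the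
Charles–Schnell fact (p124300), the weak `ℚ̄`-descent of finite étale covers (p125641, so the
Riemann-existence-with-descent fact follows from Riemann existence over `ℂ` in covering form alone,
p126127), and the Hodge–Riemann half of the BKU fact (`hodgeRiemann_polarizationForm_qbarFamily`),
and lead c10 of stmt-2409 isolated the transcendence kernel T of the `ℚ̄`-funnel ("type stability of
`(p,p)` loop-continuations at `ℚ̄`-generic points", `linearSystemTorelli_finite_setOf_isContinuationAlong_of_forall_isOfHodgeType`,
all `(n,p)`, unconditional).  The whole funnel being dimension-free, the general item inherits the
fourfold crux's two-debt residue (`linearSystemTorelli_middleDivisorSupportFourfold_of_lineResidue_of_typeStability`):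

  T(2p, p) for all p ≥ 1 → HodgeConjectureQbar → riemannExistence_finiteCovering →
    LinearSystemTorelli.DeligneGlobalInvariantCycles → MiddleDivisorSupport.

* `linearSystemTorelli_finiteMonodromyAtGenericSpread_of_typeStability` — all `(n,p)`: finite
  monodromy orbit on the `ℚ̄`-spread from type stability T(n,p), UNCONDITIONALLY (spreading out and
  the lattice argument are proved);
* `linearSystemTorelli_dominantQbarEnvelope_of_typeStability` — all `(n,p)`: the DOMINANT
  `ℚ̄`-envelope from T(n,p) modulo Riemann existence with `ℚ̄`-descent and Deligne's partie fixe;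
* `linearSystemTorelli_middleDivisorSupport_of_typeStability` — the item from T(2p,p) (`p ≥ 1`),
  HC/`ℚ̄`, Riemann existence over `ℂ` (covering form) and the route item
  `DeligneGlobalInvariantCycles` (stmt-16363): four hypotheses instead of seven, two of them open
  route inputs and two classical debts.
-/

-- every declaration of this problem lives in `Summit.HodgeConjecture.HodgeConjecture.…`
set_option linter.dupNamespace false

noncomputable section

namespace Summit.HodgeConjecture.HodgeConjecture.Theorems

open CategoryTheory AlgebraicGeometry
open _root_.Topology
open Summit.HodgeConjecture.HodgeConjecture.Theses
open Literature.AlgebraicGeometry Literature.AlgebraicGeometry.Motives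
open Literature.AlgebraicGeometry.HodgeTheory
open Literature.AlgebraicTopology.SingularHomology

/-- **Finite monodromy at the `ℚ̄`-generic spread point from type stability, all `(n,p)`,
UNCONDITIONALLY.** For `σ : ℚ̄ →+* ℂ` and `n, p`: if in every smooth projective `ℚ̄`-family of
`n`-folds (quasi-projective total space, smooth irreducible quasi-projective base), at every complex
point over the generic point of the base, every loop-continuation of a rational `(p,p)` class of
degree `2p` is again of type `(p,p)` — T(n,p) — then every rational `(p,p)` class `c` on a smooth
projective complex `n`-fold `X` has, on the `ℚ̄`-spread `e : X ≅ 𝒳_s` of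
`spreadingOut_smoothProjective_qbarFamily_holds` (PROVED), a finite monodromy orbit
(`linearSystemTorelli_finite_setOf_isContinuationAlong_of_forall_isOfHodgeType`: Hodge–Riemann for the
relative hyperplane class, polarization invariance, lattice finiteness — all PROVED).
[cite: CattaniDeligneKaplan1995JAMS, §1] [cite: BaldiKlinglerUllmo2024, §3.2]
[cite: Voisin2007HodgeLoci, §3, proof of Prop. 0.7] -/
theorem linearSystemTorelli_finiteMonodromyAtGenericSpread_of_typeStability
    (σ : AlgebraicClosure ℚ →+* ℂ) {n : ℕ} (p : ℕ)
    (hT : ∀ ⦃𝒳₀ S₀ : SchemeOver (AlgebraicClosure ℚ)⦄ (f₀ : 𝒳₀ ⟶ S₀),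
      IsQuasiProjectiveOver 𝒳₀ → IsQuasiProjectiveOver S₀ → IrreducibleSpace S₀.left →
      AlgebraicGeometry.Smooth S₀.hom → IsSmoothProjectiveFamily ((baseChangeHom σ).map f₀) n →
      ∀ (s : ComplexPoints ((baseChangeHom σ).obj S₀)),
        closure {(baseChangeHomFst σ S₀).base s.pt} = (Set.univ : Set S₀.left) →
        ∀ (α : complexBetti (fiberOver ((baseChangeHom σ).map f₀) s) (2 * p)),
          IsRationalClass α → IsOfHodgeType n (fiberOver ((baseChangeHom σ).map f₀) s) (2 * p) p p α →
          ∀ (γ : Path s s) (β : complexBetti (fiberOver ((baseChangeHom σ).map f₀) s) (2 * p)),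
            IsContinuationAlong γ α β →
              IsOfHodgeType n (fiberOver ((baseChangeHom σ).map f₀) s) (2 * p) p p β)
    {X : SchemeOver ℂ} (hX : IsSmoothProjective n X) (c : complexBetti X (2 * p))
    (hc : IsRationalClass c) (hh : IsOfHodgeType n X (2 * p) p p c) :
    ∃ (𝒳₀ S₀ : SchemeOver (AlgebraicClosure ℚ)) (f₀ : 𝒳₀ ⟶ S₀)
      (s : ComplexPoints ((baseChangeHom σ).obj S₀))
      (e : X ≅ fiberOver ((baseChangeHom σ).map f₀) s),
      IsQuasiProjectiveOver 𝒳₀ ∧ IsQuasiProjectiveOver S₀ ∧ IrreducibleSpace S₀.left ∧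
      AlgebraicGeometry.Smooth S₀.hom ∧
      IsSmoothProjectiveFamily ((baseChangeHom σ).map f₀) n ∧
      closure {(baseChangeHomFst σ S₀).base s.pt} = (Set.univ : Set S₀.left) ∧
      {β : complexBetti (fiberOver ((baseChangeHom σ).map f₀) s) (2 * p) |
          ∃ γ : Path s s, IsContinuationAlong γ (complexBetti.map e.inv (2 * p) c) β}.Finite := by
  obtain ⟨𝒳₀, S₀, f₀, s, h𝒳₀, hS₀, hirr, hsm, hf, hgen, ⟨e⟩⟩ :=
    spreadingOut_smoothProjective_qbarFamily_holds σ hX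
  refine ⟨𝒳₀, S₀, f₀, s, e, h𝒳₀, hS₀, hirr, hsm, hf, hgen, ?_⟩
  exact linearSystemTorelli_finite_setOf_isContinuationAlong_of_forall_isOfHodgeType σ f₀ n p hf h𝒳₀
    hS₀ hirr hsm s (complexBetti.map e.inv (2 * p) c) (hc.map _)
    (hT f₀ h𝒳₀ hS₀ hirr hsm hf s hgen (complexBetti.map e.inv (2 * p) c) (hc.map _)
      (hh.map_of_iso e.symm))

/-- **DominantQbarEnvelope(n,p) ⟸ T(n,p) modulo Riemann existence with `ℚ̄`-descent (C) and
Deligne's partie fixe (D)** — the all-`(n,p)` form of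
`linearSystemTorelli_dominantQbarEnvelopeFourfoldCodimTwo_of_typeStability` (lead c10): for a fixed
`σ`, every rational `(p,p)` class `c` on a smooth projective complex `n`-fold `X` is `ι^* c'` for a
`ℂ`-morphism `ι : X ⟶ W₀ ⊗_σ ℂ` DOMINANT onto the `ℚ̄`-scheme `W₀` (smooth projective
complexification) and a rational `(p,p)` class `c'` upstairs: spread and get finite monodromy from T
(`linearSystemTorelli_finiteMonodromyAtGenericSpread_of_typeStability`), take the dominant envelope
of the transported class (stub B of stmt-2409, `stub_dominantEnvelopeOfFiniteMonodromy`, p119525, all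
`(n,p)`), precompose with `e : X ≅ 𝒳_s`.
[cite: Voisin2007HodgeLoci, §3, proof of Prop. 0.7] [cite: CharlesSchnell2014Notes, Thm. 11.3.19] -/
theorem linearSystemTorelli_dominantQbarEnvelope_of_typeStability
    (σ : AlgebraicClosure ℚ →+* ℂ) {n : ℕ} (p : ℕ)
    (hT : ∀ ⦃𝒳₀ S₀ : SchemeOver (AlgebraicClosure ℚ)⦄ (f₀ : 𝒳₀ ⟶ S₀),
      IsQuasiProjectiveOver 𝒳₀ → IsQuasiProjectiveOver S₀ → IrreducibleSpace S₀.left →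
      AlgebraicGeometry.Smooth S₀.hom → IsSmoothProjectiveFamily ((baseChangeHom σ).map f₀) n →
      ∀ (s : ComplexPoints ((baseChangeHom σ).obj S₀)),
        closure {(baseChangeHomFst σ S₀).base s.pt} = (Set.univ : Set S₀.left) →
        ∀ (α : complexBetti (fiberOver ((baseChangeHom σ).map f₀) s) (2 * p)),
          IsRationalClass α → IsOfHodgeType n (fiberOver ((baseChangeHom σ).map f₀) s) (2 * p) p p α →
          ∀ (γ : Path s s) (β : complexBetti (fiberOver ((baseChangeHom σ).map f₀) s) (2 * p)),
            IsContinuationAlong γ α β →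
              IsOfHodgeType n (fiberOver ((baseChangeHom σ).map f₀) s) (2 * p) p p β)
    (hRE : Literature.AlgebraicGeometry.FundamentalGroup.riemannExistence_qbarDescent_of_finiteIndex)
    (hD : deligne_globalInvariantCycles)
    {X : SchemeOver ℂ} (hX : IsSmoothProjective n X) (c : complexBetti X (2 * p))
    (hc : IsRationalClass c) (hh : IsOfHodgeType n X (2 * p) p p c) :
    ∃ (m : ℕ) (W₀ : SchemeOver (AlgebraicClosure ℚ)) (ι : X ⟶ (baseChangeHom σ).obj W₀)
      (c' : complexBetti ((baseChangeHom σ).obj W₀) (2 * p)),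
      IsSmoothProjective m ((baseChangeHom σ).obj W₀) ∧
      DenseRange (ι.left ≫ baseChangeHomFst σ W₀).base ∧
      IsRationalClass c' ∧ IsOfHodgeType m ((baseChangeHom σ).obj W₀) (2 * p) p p c' ∧
      complexBetti.map ι (2 * p) c' = c := by
  obtain ⟨𝒳₀, S₀, f₀, s, e, h𝒳₀, hS₀, hirr, hsm, hf, hgen, hfin⟩ :=
    linearSystemTorelli_finiteMonodromyAtGenericSpread_of_typeStability σ p hT hX c hc hh
  obtain ⟨m, W₀, ι, c', hW, hdom, hc', hh', hmap⟩ :=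
    stub_dominantEnvelopeOfFiniteMonodromy hRE hD σ f₀ n p h𝒳₀ hS₀ hirr hsm hf s hgen
      (complexBetti.map e.inv (2 * p) c) (hc.map _) (hh.map_of_iso e.symm) hfin
  refine ⟨m, W₀, e.hom ≫ ι, c', hW, ?_, hc', hh', ?_⟩
  · have hsurj : Function.Surjective e.hom.left.base := e.hom.left.surjective
    have : ((e.hom ≫ ι).left ≫ baseChangeHomFst σ W₀).base =
        e.hom.left.base ≫ (ι.left ≫ baseChangeHomFst σ W₀).base := rfl
    rw [this, TopCat.coe_comp]
    exact hdom.comp hsurj.denseRange (ι.left ≫ baseChangeHomFst σ W₀).base.hom.continuous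
  · rw [complexBetti.map_comp, ModuleCat.comp_apply, hmap]
    exact e.complexBetti_map_hom_map_inv (2 * p) c

/-- **stmt-1081 ⟸ T ∧ HC/`ℚ̄` modulo TWO classical debts** (kernel-checked dedup, all even
dimensions; arrow form, registered sub-goal of stmt-HodgeConjecture-1081): every rational `(p,p)`
class in the middle degree of a smooth projective complex `2p`-fold, `p ≥ 1`, is supported on a
divisor, granted (i) T(2p,p) for all `p ≥ 1` — in smooth projective `ℚ̄`-families of `2p`-folds, at
points over the generic point of the base, loop-continuations of rational middle-degree `(p,p)`
classes are `(p,p)` (OPEN; the transcendence kernel of Voisin's `ℚ̄`-funnel, implied by the item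
itself on paper), (ii) `PeriodDeficiency.HodgeConjectureQbar` (stmt-11596), (iii) Riemann's existence
theorem over `ℂ` in covering form (`FundamentalGroup.riemannExistence_finiteCovering`, SGA1 XII 5.1)
and (iv) Deligne's théorème de la partie fixe as the route item
`LinearSystemTorelli.DeligneGlobalInvariantCycles` (stmt-16363).  Proof: fix `σ`; Riemann existence
with `ℚ̄`-descent from (iii) alone (weak descent PROVED,
`linearSystemTorelli_riemannExistence_qbarDescent_of_finiteIndex_of_riemannExistence`); the dominant
`ℚ̄`-envelope `c = ι^* c'` from T (`linearSystemTorelli_dominantQbarEnvelope_of_typeStability`); a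
proper `ℚ̄`-closed `Z₀ ⊊ W₀` off whose preimage `c'` dies, from HC/`ℚ̄` and the DISCHARGED
Charles–Schnell `ℚ̄`-support fact (`linearSystemTorelli_qbarDivisorSupport_of_hodgeConjectureQbar_codim`);
and the dominance glue (`linearSystemTorelli_map_mem_supportedClasses_one_of_preimage_ne_univ`:
`ι⁻¹ π⁻¹ Z₀` is a proper closed subset of the integral `2p`-fold).  Compared with p119978 the
hypotheses stmt-11597, stmt-11595, BKU, and the Charles–Schnell fact have left the list and the
Riemann existence fact is weakened to its covering form over `ℂ`.
[cite: Voisin2007HodgeLoci, §3, proof of Prop. 0.7] [cite: CharlesSchnell2014Notes, Thm. 11.3.19 and Remark after Cor. 11.3.16]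
[cite: SGA1, Exp. XII Thm. 5.1] [cite: DeligneHodgeII1971, Thm. 4.1.1] -/
theorem linearSystemTorelli_middleDivisorSupport_of_typeStability :
    (∀ (p : ℕ), 1 ≤ p → ∀ (σ : AlgebraicClosure ℚ →+* ℂ) ⦃𝒳₀ S₀ : SchemeOver (AlgebraicClosure ℚ)⦄
      (f₀ : 𝒳₀ ⟶ S₀), IsQuasiProjectiveOver 𝒳₀ → IsQuasiProjectiveOver S₀ → IrreducibleSpace S₀.left →
      AlgebraicGeometry.Smooth S₀.hom → IsSmoothProjectiveFamily ((baseChangeHom σ).map f₀) (2 * p) →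
      ∀ (s : ComplexPoints ((baseChangeHom σ).obj S₀)),
        closure {(baseChangeHomFst σ S₀).base s.pt} = (Set.univ : Set S₀.left) →
        ∀ (α : complexBetti (fiberOver ((baseChangeHom σ).map f₀) s) (2 * p)),
          IsRationalClass α →
          IsOfHodgeType (2 * p) (fiberOver ((baseChangeHom σ).map f₀) s) (2 * p) p p α →
          ∀ (γ : Path s s) (β : complexBetti (fiberOver ((baseChangeHom σ).map f₀) s) (2 * p)),
            IsContinuationAlong γ α β →
              IsOfHodgeType (2 * p) (fiberOver ((baseChangeHom σ).map f₀) s) (2 * p) p p β) →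
    Summit.HodgeConjecture.HodgeConjecture.Theses.PeriodDeficiency.HodgeConjectureQbar →
    Literature.AlgebraicGeometry.FundamentalGroup.riemannExistence_finiteCovering →
    Summit.HodgeConjecture.HodgeConjecture.Theses.LinearSystemTorelli.DeligneGlobalInvariantCycles →
    Summit.HodgeConjecture.HodgeConjecture.Theses.LinearSystemTorelli.MiddleDivisorSupport := by
  intro hT hQ hR hD p X hp hX c hc hh
  obtain ⟨σ⟩ := exists_ringHom_algebraicClosure_rat_complex
  obtain ⟨m, W₀, ι, c', hW, hdom, hc', hh', hmap⟩ :=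
    linearSystemTorelli_dominantQbarEnvelope_of_typeStability σ p (hT p hp σ)
      (linearSystemTorelli_riemannExistence_qbarDescent_of_finiteIndex_of_riemannExistence hR) hD hX c
      hc hh
  obtain ⟨Z₀, hZ₀, hZ₀ne, hd⟩ :=
    linearSystemTorelli_qbarDivisorSupport_of_hodgeConjectureQbar_codim
      charlesSchnell2014_algebraicClasses_supportedOn_qbarClosed_holds hQ σ hp W₀ hW c' hc' hh'
  rw [← hmap]
  -- `ι⁻¹(π⁻¹ Z₀) = (ι ≫ π)⁻¹ Z₀` definitionally (`Scheme.comp_base` is `rfl`)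
  exact linearSystemTorelli_map_mem_supportedClasses_one_of_preimage_ne_univ hX ι
    (hZ₀.preimage (baseChangeHomFst σ W₀).continuous)
    (linearSystemTorelli_preimage_ne_univ_of_denseRange hdom hZ₀ hZ₀ne) hd

end Summit.HodgeConjecture.HodgeConjecture.Theorems

end
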